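import Summits.ResolutionOfSingularities.ResolutionOfSingularities.Theorems.DeltaCutStellarHypFibre

/-!
# StellarCut T13 — «HypTame» ★ THE TAME HYPERSURFACE-SHAPE N.C. LAW `worNCHypTame_holds : WORNCHypTame n`
# (lens-6 «barrier-complement carving», g33; the cell `WORNCHypTame` of `DeltaCutStellarTame` (T8) DECIDED, +1)

THEOREM (`worNCHypTame_holds`, hypothesis-free, statement VERBATIM the T8 definition): for every `n ≥ 1`, every prime `p ∤ n`,
every base `(Y, g)` over a field of characteristic `p` (`IsBase`: separated, finite type, regular, `dim ≤ 4`) and every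
`n`-datum `M` whose stage is an n.c. HYPERSURFACE-SHAPE stage (`IsNCHypStage n`: an s.n.c. frame `H, D₁, …, D_r` with
`𝓘_y = (hⁿ + u·∏ dᵢ^{aᵢ})` at every `y ∈ H` and `Supp(𝓘, n) ⊆ H`), there is a sequence of blow-ups in regular centres
`t : CentreSeq Y` with `WeakResolution t M`.

PROOF.  `n = 1`: the support is empty (`support_ncHypShape_one_eq_empty`, T10: `V(𝓘) ⊆ V(H)` forces `h + u·m` to be a unit),
so the empty sequence resolves.  `n ≥ 2`: the shape predicate `ncHypShape n` (T10) is FACE-STABLE (`faceStableShape_ncHypShape`)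
— ROUND = generator half `DeltaCutStellarHypPersist` (T11: `𝓘' = (h'ⁿ + u'·m')` along `V(H')` at every scheme point, by the
divisor identities `π^*H = H' + F`, `π^*𝓜(E) = F^{Σa}·𝓜(E')` and the colon formula for the controlled transform) + support half
`ncHypShape.support_transform_subset` below (off the centre the blow-up is a local isomorphism; over the centre the TAME GUARD
`DeltaCutStellarHypFibre` (T12): off `V(H')` the transform has order `≤ 1 < 2 ≤ n` — [CoP1] Prop. 4.2 (a) near-point bound fed
with the fibre form `X_{l_H}ⁿ + a·X^b`, `deg b = n` a unit BECAUSE `p ∤ n`), FACE and TERMINAL = the pointwise support criterion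
of T10 — and the abstract terminating face strategy `FaceStableShape.exists_weakResolution` (T9: Kollár's (3.111) Step 3 measure
relativised to `H`) resolves every face-stable datum; the bridge `exists_ncHypShape_of_isNCHypStage` (T10) supplies the datum
from `IsNCHypStage` + `IsDatum` + `IsBase` + `¬ p ∣ n` (`n ∈ 𝒪_{Y,y}^×` via `k → Γ(Y) → 𝒪_{Y,y}`).

LOAD-BEARING BY USE (pre-ruling 222q (h3)): `HypShape` (the principal presentation, T10/T11), `SuppLE` (the support clause —
dropped, the kangaroo `(y³+x⁴)x² + z⁶w⁶` has top points off `H'`), `IsSNC` (regular stalks = domains, labelled parameters,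
[CoP1]'s regular centre), `¬ p ∣ n` (the unit `deg b` in the `H`-chart guard; dropped, `x² + (1+xz)·z²w²`, `p = n = 2`, leaves
`V(H')` along `V(z, x'+w)` — the WILD cell `WORNCHypWild`, UNDECIDED · IDEA-NEEDED).  TAME desk inhabitant: `x³ + (1+xz)·z³w³`,
characteristic `2`, `n = 3`.  `dim ≤ 4` is NOT used.  0 sorry; axioms standard. [new]
[cite: Kollar2007, (3.111) Step 3] [cite: CossartPiltant2008, Prop. 4.2 (a)]
[cite: BierstoneGrigorievMilmanWlodarczyk2011, §3.2 and §4 Step 2b]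
-/

noncomputable section

open CategoryTheory CategoryTheory.Limits AlgebraicGeometry TopologicalSpace IsLocalRing
open Literature.AlgebraicGeometry.Resolution

namespace Summit.ResolutionOfSingularities.ResolutionOfSingularities.Theorems.DeltaCutClasses

open Summit.ResolutionOfSingularities.ResolutionOfSingularities.Theorems
open WeakOrderReduction ForcedTowerClasses

/-! ### §Support — the support clause survives a face round (`n ≥ 2`) -/

section Support

variable {X X' : Scheme.{0}} [IsLocallyNoetherian X] {π : X' ⟶ X} {H : X.IdealSheafData}
  {E : List (X.IdealSheafData × ℕ)} {T : Finset X.IdealSheafData} {n : ℕ} {M : MarkedIdeal X}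

/-- **`supp M' ⊆ V(H')` after a face round, for `n ≥ 2`**: off the centre the blow-up does not change the support and `V(H)`
lifts to `V(H')`; over the centre a top point off `V(H')` would have `𝓘' ≤ 𝔪ⁿ ≤ 𝔪²`, against the tame guard (T12).
[new] [cite: CossartPiltant2008, Prop. 4.2 (a)] -/
theorem ncHypShape.support_transform_subset (hEs : HasSNC (H :: boundaryOf E)) (hT : ∀ K ∈ T, K ∈ H :: boundaryOf E)
    (hHT : H ∈ T) (hπ : IsBlowup π (T.sup id)) (hmT : n ≤ weightOf E T) (hn : 2 ≤ n) (hP : ncHypShape n X E H M) :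
    (M.transform π (T.sup id)).support ⊆ ((strictTransformIdeal π (T.sup id) H).support : Set X') := by
  haveI : IsProper π := hπ.isProper
  haveI : IsLocallyNoetherian X' := LocallyOfFiniteType.isLocallyNoetherian π
  intro x' hx'
  have hx'' : x' ∈ (M.transform π (T.sup id)).support := hx'
  by_cases hxC : π x' ∈ (T.sup id).support
  · by_contra hxH
    refine hP.not_stalkIdeal_transform_le_sq hEs hT hHT hπ hmT hxC hxH ?_
    have h := (MarkedIdeal.mem_support_iff _ _).mp hx''
    rw [MarkedIdeal.transform_mult, hP.mult_eq] at h
    exact h.trans (Ideal.pow_le_pow_right hn)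
  · exact mem_support_strictTransformIdeal_of_not_mem hxC
      (hP.support_subset ((hπ.mem_support_transform_iff_of_not_mem M hxC).mp hx''))

/-- **THE TAME HYPERSURFACE SHAPE SURVIVES A FACE ROUND** (`n ≥ 2`; T11 generator half + the support half above). [new]
[cite: Kollar2007, (3.111) Step 3] [cite: CossartPiltant2008, Prop. 4.2 (a)] -/
theorem ncHypShape.transform (hEs : HasSNC (H :: boundaryOf E)) (hT : ∀ K ∈ T, K ∈ H :: boundaryOf E) (hHT : H ∈ T)
    (hπ : IsBlowup π (T.sup id)) (hmT : n ≤ weightOf E T) (hn : 2 ≤ n) (hP : ncHypShape n X E H M) :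
    ncHypShape n X' (transformExp E π T n) (strictTransformIdeal π (T.sup id) H) (M.transform π (T.sup id)) :=
  hP.transform_of_support_subset hEs hT hHT hπ hmT (hP.support_transform_subset hEs hT hHT hπ hmT hn)

end Support

/-! ### §Law — face stability and the tame law -/

section Law

/-- **THE TAME HYPERSURFACE SHAPE IS FACE-STABLE at every marking `n ≥ 2`** (round: `ncHypShape.transform`; face / terminal: the
pointwise support criterion of T10). [new] [cite: Kollar2007, (3.111) Step 3] -/
theorem faceStableShape_ncHypShape {n : ℕ} (hn : 2 ≤ n) : FaceStableShape n (ncHypShape n) where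
  round _ _ _ _ T _ hEs hT hHT hmT hP := hP.transform hEs hT hHT (blowup.isBlowup (T.sup id)) hmT hn
  face _ _ _ _ _ _ hEs hHT hmT hP := support_finsetSup_subset_support_ncHypShape hEs hHT hmT hP
  terminal _ _ _ _ _ hEs _ hP h := support_ncHypShape_eq_empty (hasSNC_boundaryOf_of_cons hEs) hP h

/-- ★ **THE TAME HYPERSURFACE-SHAPE N.C. LAW HOLDS** — `WORNCHypTame n` for every `n ≥ 1` (module docstring).  The cell
`WORNCHypTame` of the `WORNCHyp` carving (T8) is DECIDED · HOLDS; its sibling `WORNCHypWild` (`p ∣ n`) stays UNDECIDED. [new]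
[cite: Kollar2007, (3.111) Step 3] [cite: CossartPiltant2008, Prop. 4.2 (a)] -/
theorem worNCHypTame_holds (n : ℕ) (hn : 1 ≤ n) : WORNCHypTame n := by
  intro p _ k _ _ Y g hB hpn M hM hNC
  haveI := hB.locallyOfFiniteType
  haveI := hB.quasiCompact
  haveI : IsLocallyNoetherian Y := LocallyOfFiniteType.isLocallyNoetherian g
  obtain ⟨E, H, hEs, hH, hP⟩ := exists_ncHypShape_of_isNCHypStage g hB hpn hM hNC
  rcases (show n = 1 ∨ 2 ≤ n by omega) with rfl | hn2
  · exact ⟨.nil Y, weakResolution_nil_of_support_eq_empty M (support_ncHypShape_one_eq_empty hEs hP)⟩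
  · exact (faceStableShape_ncHypShape hn2).exists_weakResolution hEs hH M hP

/-- the FAMILY of tame laws `E1NCHypTame` (all markings `n ≥ 1`) holds. [new] -/
theorem e1NCHypTame_holds : E1NCHypTame := worNCHypTame_holds

/-- at marking `1` the whole hypersurface-shape n.c. law holds (the wild cell is vacuous there, `worNCHypWild_one`). [new] -/
theorem worNCHyp_one : WORNCHyp 1 := worNCHyp_of_tame_wild (worNCHypTame_holds 1 le_rfl) worNCHypWild_one

/-- per level, the hypersurface-shape law now reduces to its WILD cell: `WORNCHypWild n → WORNCHyp n`. [new] -/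
theorem worNCHyp_of_wild {n : ℕ} (hn : 1 ≤ n) (hW : WORNCHypWild n) : WORNCHyp n :=
  worNCHyp_of_tame_wild (worNCHypTame_holds n hn) hW

/-- per level: the n.c.-regime part of the residual from the wild cell alone, `WORNCHypWild n → WORTopSHeavyNC n`. [new] -/
theorem worTopSHeavyNC_of_wild {n : ℕ} (hn : 1 ≤ n) (hW : WORNCHypWild n) : WORTopSHeavyNC n :=
  worTopSHeavyNC_of_tame_wild hn (worNCHypTame_holds n hn) hW

/-- families: `E1NCHypWild → E1NCHyp`. [new] -/
theorem e1NCHyp_of_wild (hW : E1NCHypWild) : E1NCHyp := e1NCHyp_of_tame_wild e1NCHypTame_holds hW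

end Law

/-! ### §Carve — the column's carve with the tame cell DISCHARGED -/

section Carve

open SubfieldContactClasses

/-- **THE CARVE AFTER `WORNC` AND `WORNCHypTame`**: `E1NCHypWild → E1NCEntryPerpetual → E1TopSFrozenOffNC → E1TopSHeavy`. [new] -/
theorem e1TopSHeavy_of_wild (hW : E1NCHypWild) (hE : E1NCEntryPerpetual) (hO : E1TopSFrozenOffNC) : E1TopSHeavy :=
  e1TopSHeavy_of_tame_wild e1NCHypTame_holds hW hE hO

/-- exact remainder form: `E1NCHypWild → E1TopSHeavyOffNC → E1TopSHeavy`. [new] -/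
theorem e1TopSHeavy_of_wild_offNC (hW : E1NCHypWild) (hO : E1TopSHeavyOffNC) : E1TopSHeavy :=
  e1TopSHeavy_of_tame_wild_offNC e1NCHypTame_holds hW hO

/-- edge to the live aside (item 27045): under `E 5`, `E1NCHypWild → E1NCEntryPerpetual → E1TopSFrozenOffNC → E1TopGHeavy`. [new] -/
theorem e1TopGHeavy_of_wild (h5 : E 5) (hW : E1NCHypWild) (hE : E1NCEntryPerpetual) (hO : E1TopSFrozenOffNC) : E1TopGHeavy :=
  e1TopGHeavy_of_tame_wild h5 e1NCHypTame_holds hW hE hO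

/-- edge to the column item (26971): under `SubfieldContactAbs` and `E 5`,
`E1NCHypWild → E1NCEntryPerpetual → E1TopSFrozenOffNC → E1TopNoAbs`. [new] -/
theorem e1TopNoAbs_of_wild (hSC : SubfieldContactAbs) (h5 : E 5) (hW : E1NCHypWild) (hE : E1NCEntryPerpetual)
    (hO : E1TopSFrozenOffNC) : E1TopNoAbs :=
  e1TopNoAbs_of_tame_wild hSC h5 e1NCHypTame_holds hW hE hO

/-- summit edge of the column: under `SubfieldContactAbs` and `E 5`, `E1NCHypWild → E1NCEntryPerpetual → E1TopSFrozenOffNC → E 1`.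
[new] -/
theorem e_one_of_wild (hSC : SubfieldContactAbs) (h5 : E 5) (hW : E1NCHypWild) (hE : E1NCEntryPerpetual)
    (hO : E1TopSFrozenOffNC) : E 1 :=
  e_one_of_tame_wild hSC h5 e1NCHypTame_holds hW hE hO

end Carve

end Summit.ResolutionOfSingularities.ResolutionOfSingularities.Theorems.DeltaCutClasses
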